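import Summits.QuantumFields.YangMills.Theorems.BalabanUVNodesN27LedgerJoinN17
import Literature.MathematicalPhysics.QuantumFieldTheory.Balaban1983to89.T4MatchingClosureSocket

/-!
# BalabanUVNodes ∕ N27 spine-record join, IX — THE BUDGET CLAUSE `W + Wsh < 1` DISCHARGED IN THE TAIL: the `lt_one` field of
# `HybridNE7` is NOT asked; it holds from some origin on by the children's OWN summability clauses (`RelWeightBound.summable`
# of N20, `ShellWeightBound.summable` of N21, `T4MatchingClosure.eventually_budget_lt_one`), everything else being shifted to
# that origin — the tree's typing decision (Z3) of `T4MatchingClosureSocket.hybridNE7_closure'_tail`, adopted for the term-wise joins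
# (cell `pub-ymgap`, HUMAN RULING D-0062 Track A, seat `pub-ymgap-dag-n27-a` g3; `--supports stmt-QuantumFields-19182`, count-neutral)

WHY.  Every join of this seat so far (g0 §2; files I–VIII) asks, next to N20 `RelWeightBound … W` and N21 `ShellWeightBound … Wsh`, the
budget clause `∀ K, W K + Wsh K < 1` (field `lt_one` of `T4MatchingAssembly.HybridNE7`, consumed by `Spine.NE7.hybridNE7_of_core`).  The two
children's decls of record CARRY `Summable W` resp. `Summable Wsh`, so `W K + Wsh K < 1` holds for `K ≥ K₁` for some `K₁`
(`T4MatchingClosure.eventually_budget_lt_one`), and every other ingredient is stable under the origin shift `K ↦ K₁ + K`: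
`T4MatchingClosureSocket.relWeightBound_shift` ∕ `shellWeightBound_shift` (tree), `Spine.NE7.Core` (§1, one line), `Summable δ`
(`Summable.comp_injective`), and the E1∕E2 dictionary re-based from `K₀` to `K₀ + K₁` (`T4MatchingClosure.stringHybridNE7_of_shift`, tree).
Binder B5's currency `StringwiseHybridNE7` quantifies the offset existentially (`∃ l₀ vol K₀, …`), so the shift is absorbed and the budget
clause DISAPPEARS from the hypothesis list of the N27 join.  After this file the join's hypotheses are: N16 · N17 (+ node U2's moduli + one
printed-type β bound) · N18 · N22 · N19's Link `LedgerAt` · N20 · N21 · E1∕E2 · the printed-grade brackets — and NOTHING for `lt_one` ∕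
`summable` (the latter delivered with `core` by the N19 knit since file I).

WHAT IS KERNEL-CHECKED ([bookkeeping] ∕ [folklore]; 0 `def`, 0 `sorry`).
* §1 `core_shift` (`Spine.NE7.Core` is stable under origin shifts) · `hybridNE7_of_core_tail` (N20 + N21 + `Core δ` + `Summable δ` ⇒
  `∃ K₁, HybridNE7` for the `K₁`-shifted families — `Spine.NE7.hybridNE7_of_core` MINUS `hlt`) · `stringHybridNE7_of_spineNodes_tail`
  (+ E1∕E2 at offset `K₀` ⇒ `∃ K₁, StringHybridNE7 S os l₀ vol (K₀ + K₁)` — file I's `stringHybridNE7_of_spineNodes_exists` MINUS `hlt`).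
* §2 `stringHybridNE7_of_ledgerAt_tail` — file VI §1 MINUS `hlt`.
* §3 `hybridNE7Under_of_ledgerPackage_tuned_tail` — file VII §1 with the budget clause REMOVED from the per-string ∃-package;
  `hybridNE7Under_of_declColumns_tail` — file VIII §3 likewise: every K4 child by its DECL column (N16 `NE3Shape`, N17 `NE4OnData D` +
  moduli + `BetaUpperH`, N18 `NE5`, N22 `NE9 ∧ FadingMemory`), K5 by `RelWeightBound` ∕ `ShellWeightBound` ∕ `LedgerAt`, E1∕E2,
  `PolyLipGrowth` — and NO budget clause ⇒ `T4ApexHybrid.HybridNE7Under D Hβ`.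

HONEST FRAMING.  COMPOSITE-node bookkeeping with the children's children as hypotheses: NE3∕NE4∕NE5∕NE9∕NE7b∕NE7c are HYPOTHESIS SHAPES (none
printed for Bałaban's d = 4 procedure, none proved); `LedgerAt` is NODE O content typed by dag-n19-b; nothing of Bałaban's objects is
instantiated; NO node is discharged; (B) and `Hβ` are antecedents, used, never refuted; one fixed finite four-torus — NOT ℝ⁴, NOT infinite
volume, NOT OS axioms, NOT a mass gap, NOT Clay.  Typed 28∕28; the discharged count is not touched by this file.  No decl below carries a
cite tag.
-/

open Finset MeasureTheory

namespace Summit.QuantumFields.YangMills.Theorems.BalabanUVNodesN27SpineRecord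

open Literature.MathematicalPhysics.QuantumFieldTheory.Balaban1983to89
open Literature.MathematicalPhysics.QuantumFieldTheory.Balaban1983to89.FlowStep (HBeta BetaUpperH)
open Literature.MathematicalPhysics.QuantumFieldTheory.Balaban1983to89.T4CouplingMatching (ScaleShiftRate HistLipschitz)
open Literature.MathematicalPhysics.QuantumFieldTheory.Balaban1983to89.T4Continuum
open T4OutputRate T4RecentScale T4GoodClassBudget T4CauchySum T4TowerRateComposition T4TowerRateDischarge T4TermwiseBudget
open T4WeightBudget (RelWeightBound)
open T4IndicatorShell (ShellWeightBound)
open T4MatchingAssembly (HybridNE7 StringHybridNE7)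
open T4MatchingClosure (eventually_budget_lt_one stringHybridNE7_of_shift)
open T4MatchingClosureSocket (relWeightBound_shift shellWeightBound_shift)
open T4EtaRateMin (Readings LocalRate NE3Shape)
open T4RateLiaison (GaugeDominated)
open T4ContinuumYM4Torus (ForSmallCouplings)
open T4FlagMemory (extd)
open FlowStep (prefixOf)
open Summit.QuantumFields.BalabanUV.T4Continuum.Spine
open Summit.QuantumFields.BalabanUV.T4Continuum.Spine.NE4 (NE4OnData U2Output runFlow)
open Summit.QuantumFields.YangMills.BalabanUVNodes.N19SizeWindow (LedgerData LedgerAt core_summable_of_ledgerAt)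
open Summit.QuantumFields.YangMills.Theorems.BalabanUVNodesN17 (u2Output_under_of_N17_gap)

/-! ## §1 Origin shifts: `Core`, the hybrid datum without the budget clause, one string without the budget clause -/

section Shift

variable {ι : Type*} [DecidableEq ι] {l₀ vol : ℝ} {T : ℕ → Finset ι} {Bad : ℕ → ℝ → Finset ι}
  {P Q A B shA shB : ℕ → ℝ → ι → ℝ} {W Wsh δ : ℕ → ℝ}

/-- `Spine.NE7.Core` (NE7's term-wise half on the good classes: per cutoff one `t`-independent constant) is stable under the origin shift
`K ↦ K₁ + K` — every clause is per `K`. [bookkeeping] [folklore] -/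
theorem core_shift (K₁ : ℕ) (h : NE7.Core l₀ vol T Bad P Q δ) :
    NE7.Core l₀ vol (fun K => T (K₁ + K)) (fun K => Bad (K₁ + K)) (fun K => P (K₁ + K)) (fun K => Q (K₁ + K))
      fun K => δ (K₁ + K) :=
  fun K => h (K₁ + K)

/-- **`HybridNE7` FROM SOME ORIGIN ON, THE BUDGET CLAUSE NOT ASKED** (`Spine.NE7.hybridNE7_of_core` MINUS `hlt`): N20 `RelWeightBound … W`,
N21 `ShellWeightBound … Wsh`, NE7's `Core` on the shell-free cores with a summable `δ` ⇒ for some `K₁` the `K₁`-SHIFTED families carry a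
`HybridNE7` datum.  `W K + Wsh K < 1` holds for `K ≥ K₁` by `T4MatchingClosure.eventually_budget_lt_one` applied to the two structures' OWN
fields `RelWeightBound.summable`, `ShellWeightBound.summable`; the rest is shifted (`relWeightBound_shift`, `shellWeightBound_shift`,
`core_shift`, `Summable.comp_injective`).  The tree's typing decision (Z3) (`T4MatchingClosureSocket.hybridNE7_closure'_tail`) in the
term-wise road's letter. [bookkeeping] [folklore] -/
theorem hybridNE7_of_core_tail (hW : RelWeightBound l₀ T A B Bad W) (hSh : ShellWeightBound l₀ T A B shA shB Wsh)
    (hδ : Summable δ)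
    (hcore : NE7.Core l₀ vol T Bad (fun K t τ => A K t τ - shA K t τ) (fun K t τ => B K t τ - shB K t τ) δ) :
    ∃ K₁, HybridNE7 l₀ vol (fun K => T (K₁ + K)) (fun K => A (K₁ + K)) (fun K => B (K₁ + K)) (fun K => Bad (K₁ + K))
      (fun K => W (K₁ + K)) (fun K => shA (K₁ + K)) (fun K => shB (K₁ + K)) (fun K => Wsh (K₁ + K))
      fun K => δ (K₁ + K) := by
  obtain ⟨K₁, hK₁⟩ := eventually_budget_lt_one hW.summable hSh.summable
  exact ⟨K₁, NE7.hybridNE7_of_core (relWeightBound_shift K₁ hW) (shellWeightBound_shift K₁ hSh)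
    (fun K => hK₁ (K₁ + K) (Nat.le_add_right K₁ K)) (hδ.comp_injective (add_right_injective K₁))
    (core_shift K₁ hcore)⟩

end Shift

section SchemeTail

variable {G : Type*} [GaugeGroup G] [MeasurableSpace G] [HaarData G] {O : Type*}
  {σ : Type} [DecidableEq σ] {l₀ vol : ℝ} {T : ℕ → Finset σ} {Bad : ℕ → ℝ → Finset σ}
  {A B shA shB : ℕ → ℝ → σ → ℝ} {W Wsh : ℕ → ℝ}

/-- **ONE STRING, N19 ∧ U4′ OPAQUE, THE BUDGET CLAUSE NOT ASKED** (file I's `stringHybridNE7_of_spineNodes_exists` MINUS `hlt`): N20 · N21 ·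
`∃ δ, Spine.NE7.Core … δ ∧ Summable δ` on the shell-free cores · the E1∕E2 dictionary from cutoff `K₀` on ⇒ for some `K₁`,
`StringHybridNE7 S os l₀ vol (K₀ + K₁)` (`hybridNE7_of_core_tail`, then the dictionary re-based by `T4MatchingClosure.stringHybridNE7_of_shift`).
[bookkeeping] [folklore] -/
theorem stringHybridNE7_of_spineNodes_tail (S : Missing.TorusScheme G O) (os : List O) (K₀ : ℕ)
    (h20 : RelWeightBound l₀ T A B Bad W) (h21 : ShellWeightBound l₀ T A B shA shB Wsh)
    (h19 : ∃ δ : ℕ → ℝ,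
      NE7.Core l₀ vol T Bad (fun K t τ => A K t τ - shA K t τ) (fun K t τ => B K t τ - shB K t τ) δ ∧ Summable δ)
    (hE1 : ∀ (K : ℕ) (t : ℝ), |t| ≤ l₀ → T4GenFunBounds.schemeZ S os (K₀ + K) t = ∑ τ ∈ T K, A K t τ)
    (hE2 : ∀ (K : ℕ) (t : ℝ), |t| ≤ l₀ → T4GenFunBounds.schemeZ S os (K₀ + K + 1) t = ∑ τ ∈ T K, B K t τ) :
    ∃ K₁, StringHybridNE7 S os l₀ vol (K₀ + K₁) := by
  obtain ⟨δ, hcore, hδ⟩ := h19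
  obtain ⟨K₁, h⟩ := hybridNE7_of_core_tail h20 h21 hδ hcore
  exact ⟨K₁, stringHybridNE7_of_shift S os K₀ K₁ h hE1 hE2⟩

end SchemeTail

/-! ## §2 One string from the ledger predicate of record, the budget clause not asked -/

section SchemeLedger

variable {G : Type*} [GaugeGroup G] [MeasurableSpace G] [HaarData G] {O : Type*}
  {C : Carriers} {ι X : Type} [MeasurableSpace ι] {σ : Type} [DecidableEq σ] {L : LedgerData C ι σ} {l₀ vol : ℝ}
  {T : ℕ → Finset σ} {Bad : ℕ → ℝ → Finset σ} {A B shA shB : ℕ → ℝ → σ → ℝ} {W Wsh : ℕ → ℝ}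
  {R : Readings ι X} {Wset : Set (ℕ → ℝ)} {EA : Functional C C.BgA} {EB : Functional C C.BgB}
  {κ θ₅ C₅ C₉ ω θc Cd γ C₃ θ₃ P : ℝ} {q : ℕ} {Λm : ℕ → ℕ → ℝ} {CU : (ℕ → ℝ) → ℕ → ℝ} {g : ℕ → ℕ → ℝ}
  {uA : ℕ → ι → C.BgA} {uB : ℕ → ι → C.BgB}

/-- **ONE STRING FROM THE LEDGER PREDICATE OF RECORD, THE BUDGET CLAUSE NOT ASKED** (file VI §1 `stringHybridNE7_of_ledgerAt` MINUS `hlt`):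
N20 · N21 · E1∕E2 from `K₀` on · `LedgerAt L l₀ vol T Bad (A − shA) (B − shB) …` · the in-edges (N22, node U3's bracket, N18, N16 as `LocalRate` +
liaison) · N17's out-edge `InjectedRate` on the box · the windows ⇒ `∃ K₁, StringHybridNE7 S os l₀ vol (K₀ + K₁)`
(`core_summable_of_ledgerAt` then §1).  CONDITIONAL on every binder. [bookkeeping] [folklore] -/
theorem stringHybridNE7_of_ledgerAt_tail (S : Missing.TorusScheme G O) (os : List O) (K₀ : ℕ)
    (h20 : RelWeightBound l₀ T A B Bad W) (h21 : ShellWeightBound l₀ T A B shA shB Wsh)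
    (hE1 : ∀ (K : ℕ) (t : ℝ), |t| ≤ l₀ → T4GenFunBounds.schemeZ S os (K₀ + K) t = ∑ τ ∈ T K, A K t τ)
    (hE2 : ∀ (K : ℕ) (t : ℝ), |t| ≤ l₀ → T4GenFunBounds.schemeZ S os (K₀ + K + 1) t = ∑ τ ∈ T K, B K t τ)
    (hL : LedgerAt L l₀ vol T Bad (fun K t τ => A K t τ - shA K t τ) (fun K t τ => B K t τ - shB K t τ)
      R EA EB κ g uA uB ω θc θ₅ θ₃)
    (h22 : NE9 EA Wset κ Λm ∧ FadingMemory C₉ ω Λm) (hω : 0 ≤ ω)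
    (hUL : LipBackground EA Wset κ CU) (hG : PolyLipGrowth CU g P q) (hP : 0 ≤ P)
    (h18 : NE5 EA EB Wset κ θ₅ C₅) (hθ₅ : 0 ≤ θ₅) (hC₅ : 0 ≤ C₅)
    (hloc : LocalRate R C₃ θ₃) (hC₃ : 0 ≤ C₃) (hθ₃ : 0 ≤ θ₃) (hθ₃1 : θ₃ < 1) (hgd : GaugeDominated R uA uB)
    (hinj : InjectedRate Cd 0 θc (fun K j => T4CouplingMatching.disc (g K) (g (K + 1)) j)) (hCd : 0 ≤ Cd)
    (hθc : 0 ≤ θc) (hbox : ∀ K i, i ≤ K → 0 < g K i ∧ g K i ≤ γ)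
    (hgA : ∀ K, g K ∈ Wset) (hgB : ∀ K, (fun i => g (K + 1) (i + 1)) ∈ Wset) :
    ∃ K₁, StringHybridNE7 S os l₀ vol (K₀ + K₁) :=
  stringHybridNE7_of_spineNodes_tail S os K₀ h20 h21
    (core_summable_of_ledgerAt hL h22.1 h22.2 hω hUL hG hP h18 hθ₅ hC₅ hloc hC₃ hθ₃ hθ₃1 hgd hinj hCd hθc hbox hgA hgB)
    hE1 hE2

end SchemeLedger

/-! ## §3 The datum: the ∃-package and the DECL-column forms WITHOUT the budget clause -/

section Datum

variable {F : T4Family} {G : Type*} [GaugeGroup G] [MeasurableSpace G] [HaarData G]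
  {C : Carriers} {ι X : Type} [MeasurableSpace ι]
  {R : Readings ι X} {Wset : Set (ℕ → ℝ)} {EA : Functional C C.BgA} {EB : Functional C C.BgB}
  {κ θ₅ C₅ C₉ ω C₃ θ₃ P γu : ℝ} {q : ℕ} {Λm : ℕ → ℕ → ℝ} {CU : (ℕ → ℝ) → ℕ → ℝ}
  {uA : ℕ → ι → C.BgA} {uB : ℕ → ι → C.BgB}
  {c θ γ₄ C₄ ν β' : ℝ} {Λ₄ : ℕ → ℕ → ℝ}

/-- **N27 = B5 AT THE DATUM FROM A PER-STRING ∃-PACKAGE, LINK BY NAME, CLAMPED TABLES — THE BUDGET CLAUSE NOT ASKED.**  File VII §1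
(`hybridNE7Under_of_ledgerPackage_tuned`) with the conjunct `∀ K, W K + Wsh K < 1` REMOVED from the package: per string the package carries
`0 < l₀`, `0 < vol`, N20 `RelWeightBound`, N21 `ShellWeightBound`, E1∕E2 vs `schemeZ (D.scheme g₀) os (K₀ + K)`, `PolyLipGrowth` and `LedgerAt`
at the clamped tables `K ↦ extd (prefixOf (runFlow D g₀ (K₀ + K)) (K₀ + K))`; top level N16 `LocalRate` + liaison ∕ N18 ∕ N22 ∕
`LipBackground` ∕ `hWin`; under the prefix `hU2` (edge N17 → N27).  Per tuned `g₀` and string: box and windows from `Tuned`, `hU2` transferred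
(`injectedRate_clamped`), §2 gives `StringHybridNE7` from the shifted offset `K₀ + K₁`, which B5's currency `StringwiseHybridNE7` absorbs.
CONCLUSION: `T4ApexHybrid.HybridNE7Under D Hβ`.  CONDITIONAL on every binder; nothing of Bałaban's instantiated; NOT a discharge.
[bookkeeping] [folklore] -/
theorem hybridNE7Under_of_ledgerPackage_tuned_tail (D : FiniteEpsData F G) {Hβ : Prop} {Cd θc : ℝ}
    (hγu : 0 < γu) (hWin : Window γu ⊆ Wset)
    (hloc : LocalRate R C₃ θ₃) (hC₃ : 0 ≤ C₃) (hθ₃ : 0 ≤ θ₃) (hθ₃1 : θ₃ < 1) (hgd : GaugeDominated R uA uB)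
    (h18 : NE5 EA EB Wset κ θ₅ C₅) (hθ₅ : 0 ≤ θ₅) (hC₅ : 0 ≤ C₅)
    (h22 : NE9 EA Wset κ Λm ∧ FadingMemory C₉ ω Λm) (hω : 0 ≤ ω)
    (hUL : LipBackground EA Wset κ CU) (hP : 0 ≤ P) (hCd : 0 ≤ Cd) (hθc : 0 ≤ θc)
    (hU2 : D.UnderHypotheses Hβ fun g₀ => U2Output D g₀ Cd θc)
    (hPkg : D.UnderHypotheses Hβ fun g₀ => ∀ os : List (ULoop F),
      ∃ (σ : Type) (_ : DecidableEq σ) (L : LedgerData C ι σ) (l₀ vol : ℝ) (K₀ : ℕ) (T : ℕ → Finset σ)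
        (Bad : ℕ → ℝ → Finset σ) (A B shA shB : ℕ → ℝ → σ → ℝ) (W Wsh : ℕ → ℝ),
        0 < l₀ ∧ 0 < vol ∧ RelWeightBound l₀ T A B Bad W ∧ ShellWeightBound l₀ T A B shA shB Wsh ∧
        (∀ (K : ℕ) (t : ℝ), |t| ≤ l₀ → T4GenFunBounds.schemeZ (D.scheme g₀) os (K₀ + K) t = ∑ τ ∈ T K, A K t τ) ∧
        (∀ (K : ℕ) (t : ℝ), |t| ≤ l₀ → T4GenFunBounds.schemeZ (D.scheme g₀) os (K₀ + K + 1) t = ∑ τ ∈ T K, B K t τ) ∧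
        PolyLipGrowth CU (fun K => extd (prefixOf (runFlow D g₀ (K₀ + K)) (K₀ + K))) P q ∧
        LedgerAt L l₀ vol T Bad (fun K t τ => A K t τ - shA K t τ) (fun K t τ => B K t τ - shB K t τ) R EA EB κ
          (fun K => extd (prefixOf (runFlow D g₀ (K₀ + K)) (K₀ + K))) uA uB ω θc θ₅ θ₃) :
    T4ApexHybrid.HybridNE7Under D Hβ := by
  intro hB hβ
  have H1 : ForSmallCouplings D _ := hU2 hB hβ
  have H2 : ForSmallCouplings D _ := hPkg hB hβ
  obtain ⟨γ₀, hγ₀, Hγ⟩ := H1.and H2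
  -- shrink the `γ`-threshold to `≤ γᵤ`, so that the tuned runs' window `Window γ` sits inside `Wset`
  refine ⟨min γ₀ γu, lt_min hγ₀ hγu, fun γ hγ hγle => ?_⟩
  obtain ⟨g₁, hg₁, Hg⟩ := Hγ γ hγ (hγle.trans (min_le_left _ _))
  refine ⟨g₁, hg₁, fun gIR hgIR hgIRle g₀ ht os => ?_⟩
  obtain ⟨hu2, hpkg⟩ := Hg gIR hgIR hgIRle g₀ ht
  obtain ⟨σ, _, L, l₀, vol, K₀, T, Bad, A, B, shA, shB, W, Wsh, hl₀, hvol, h20, h21, hE1, hE2, hG, hL⟩ := hpkg os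
  have hWγ : Window γ ⊆ Wset := fun h hh => hWin fun i => ⟨(hh i).1, (hh i).2.trans (hγle.trans (min_le_right _ _))⟩
  -- the runs stay in `]0, γ]` (Tuned), so the clamped tables are in the window and in the box
  have hrun : ∀ K i, i ≤ K₀ + K → 0 < runFlow D g₀ (K₀ + K) i ∧ runFlow D g₀ (K₀ + K) i ≤ γ := fun K i hi =>
    (ht (K₀ + K)).1 i hi
  have hgA : ∀ K, extd (prefixOf (runFlow D g₀ (K₀ + K)) (K₀ + K)) ∈ Wset := fun K =>
    hWγ (extd_prefixOf_mem_window (hrun K))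
  have hgB : ∀ K, (fun i => extd (prefixOf (runFlow D g₀ (K₀ + (K + 1))) (K₀ + (K + 1))) (i + 1)) ∈ Wset := fun K =>
    hWγ (extd_prefixOf_succ_mem_window (hrun (K + 1)))
  have hbox : ∀ K i, i ≤ K → 0 < extd (prefixOf (runFlow D g₀ (K₀ + K)) (K₀ + K)) i ∧
      extd (prefixOf (runFlow D g₀ (K₀ + K)) (K₀ + K)) i ≤ γ := fun K i hi => by
    rw [T4FlagMemoryTwoRun.extd_prefixOf (show i ≤ K₀ + K by omega)]
    exact hrun K i (by omega)
  have hinj : InjectedRate Cd 0 θc fun K j => T4CouplingMatching.disc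
      (extd (prefixOf (runFlow D g₀ (K₀ + K)) (K₀ + K))) (extd (prefixOf (runFlow D g₀ (K₀ + (K + 1))) (K₀ + (K + 1)))) j :=
    injectedRate_clamped D hu2 K₀ (g := fun K => extd (prefixOf (runFlow D g₀ (K₀ + K)) (K₀ + K))) fun _ => rfl
  obtain ⟨K₁, hstr⟩ := stringHybridNE7_of_ledgerAt_tail (g := fun K => extd (prefixOf (runFlow D g₀ (K₀ + K)) (K₀ + K)))
    (D.scheme g₀) os K₀ h20 h21 hE1 hE2 hL h22 hω hUL hG hP h18 hθ₅ hC₅ hloc hC₃ hθ₃ hθ₃1 hgd hinj hCd hθc hbox hgA hgB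
  exact ⟨l₀, vol, K₀ + K₁, hl₀, hvol, hstr⟩

/-- **N27 = B5 AT THE DATUM FROM THE K4 CHILDREN'S DECL COLUMNS AND THE K5 LINK RECORD — THE BUDGET CLAUSE NOT ASKED** (file VIII §3
`hybridNE7Under_of_ledgerPackage_tuned_of_declColumns` MINUS the budget conjunct): N16 `NE3Shape R C₃ θ₃` + liaison, N17 `NE4OnData D c θ γ₄`
+ node U2's moduli `HistLipschitz Λ₄ γ₄ D.βfun`, `FadingMemory C₄ ν Λ₄` (`0 ≤ ν < θ < 1`) + the printed-type `BetaUpperH β′ γ₄ D.βfun`,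
`γ₄²β′ < 1` (dag-n17-a's AF-free gap road `u2Output_under_of_N17_gap`), N18 `NE5`, N22 `NE9 ∧ FadingMemory`, `LipBackground`, `hWin`; under the
prefix per string the ∃-package `0 < l₀`, `0 < vol`, N20 `RelWeightBound`, N21 `ShellWeightBound`, E1∕E2, `PolyLipGrowth`, N19's Link
`LedgerAt` (at `θc := θ`) at the clamped tables ⇒ `T4ApexHybrid.HybridNE7Under D Hβ`.  The hypothesis list is now EXACTLY the children's
decls of record + the E1∕E2 dictionary + the printed-grade brackets: the fields `lt_one` and `summable` of `HybridNE7` are THEOREMS of the join.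
CONDITIONAL on every binder; none of NE3∕NE4∕NE5∕NE9∕NE7b∕NE7c is thereby proved; NOT a discharge. [bookkeeping] [folklore] -/
theorem hybridNE7Under_of_declColumns_tail (D : FiniteEpsData F G) {Hβ : Prop}
    (h16 : NE3Shape R C₃ θ₃) (hC₃ : 0 ≤ C₃) (hgd : GaugeDominated R uA uB)
    (h17 : NE4OnData D c θ γ₄) (hL4 : HistLipschitz Λ₄ γ₄ D.βfun) (hΛ4 : FadingMemory C₄ ν Λ₄)
    (hc : 0 ≤ c) (hC₄ : 0 ≤ C₄) (hν0 : 0 ≤ ν) (hνθ : ν < θ) (hθ1 : θ < 1) (hγ₄ : 0 < γ₄)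
    (hhi : BetaUpperH β' γ₄ D.βfun) (hγβ : γ₄ ^ 2 * β' < 1)
    (h18 : NE5 EA EB Wset κ θ₅ C₅) (hθ₅ : 0 ≤ θ₅) (hC₅ : 0 ≤ C₅)
    (h22 : NE9 EA Wset κ Λm ∧ FadingMemory C₉ ω Λm) (hω : 0 ≤ ω)
    (hUL : LipBackground EA Wset κ CU) (hP : 0 ≤ P) (hγu : 0 < γu) (hWin : Window γu ⊆ Wset)
    (hPkg : D.UnderHypotheses Hβ fun g₀ => ∀ os : List (ULoop F),
      ∃ (σ : Type) (_ : DecidableEq σ) (L : LedgerData C ι σ) (l₀ vol : ℝ) (K₀ : ℕ) (T : ℕ → Finset σ)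
        (Bad : ℕ → ℝ → Finset σ) (A B shA shB : ℕ → ℝ → σ → ℝ) (W Wsh : ℕ → ℝ),
        0 < l₀ ∧ 0 < vol ∧ RelWeightBound l₀ T A B Bad W ∧ ShellWeightBound l₀ T A B shA shB Wsh ∧
        (∀ (K : ℕ) (t : ℝ), |t| ≤ l₀ → T4GenFunBounds.schemeZ (D.scheme g₀) os (K₀ + K) t = ∑ τ ∈ T K, A K t τ) ∧
        (∀ (K : ℕ) (t : ℝ), |t| ≤ l₀ → T4GenFunBounds.schemeZ (D.scheme g₀) os (K₀ + K + 1) t = ∑ τ ∈ T K, B K t τ) ∧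
        PolyLipGrowth CU (fun K => extd (prefixOf (runFlow D g₀ (K₀ + K)) (K₀ + K))) P q ∧
        LedgerAt L l₀ vol T Bad (fun K t τ => A K t τ - shA K t τ) (fun K t τ => B K t τ - shB K t τ) R EA EB κ
          (fun K => extd (prefixOf (runFlow D g₀ (K₀ + K)) (K₀ + K))) uA uB ω θ θ₅ θ₃) :
    T4ApexHybrid.HybridNE7Under D Hβ :=
  have hθ0 : 0 ≤ θ := hν0.trans hνθ.le
  hybridNE7Under_of_ledgerPackage_tuned_tail D hγu hWin h16.pointwise hC₃ h16.rate_nonneg h16.rate_lt_one hgd h18 hθ₅ hC₅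
    h22 hω hUL hP (div_nonneg (mul_nonneg zero_le_two hc) (sub_nonneg.mpr hθ1.le)) hθ0
    (u2Output_under_of_N17_gap D h17 hL4 hΛ4 hc hC₄ hν0 hνθ hθ1 hγ₄ hhi hγβ) hPkg

end Datum

end Summit.QuantumFields.YangMills.Theorems.BalabanUVNodesN27SpineRecord
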